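import Literature.MathematicalPhysics.QuantumLattice.HubbardTTPrimePointGroupCovariance
import Literature.MathematicalPhysics.QuantumLattice.InfVolFermionStateGaugeAction
import Literature.MathematicalPhysics.QuantumLattice.InfVolFermionStateSpinFlip
import Literature.MathematicalPhysics.QuantumLattice.HubbardNNNHoppingTwistedFlipWindowCertificate
import HarnessLib

/-!
# The gauge-TWISTED `D₄ × ℤ₂^{flip}` group acting on infinite-volume fermion states on `ℤ²`; its symmetry
# defects cancel in orbit sums

Topic `Literature/MathematicalPhysics/QuantumLattice` (namespace = path); cell `hubbard-cq`, seat `hubbard-cq-obsth-1`.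
Companion of `InfVolFermionStatePointGroupAction` (`d4Act`), `InfVolFermionStateSpinFlip` (`spinFlip`),
`InfVolFermionStateGaugeAction` (`gaugeShift`) and of the TORUS family `twistedFlipSpaceGroupUnitary`: the identification
under which the cell's pair-SOURCED moment relaxations are built (engine obsb ≥ 0.3.0, `gauge_twist` + `spin_flip`) is the
32-element family of automorphisms `α_{(γ,f,m)} = γ_{θ(γ,f,m)} ∘ F^f ∘ γ` of the CAR algebra over `ℤ² × {↑,↓}` (`γ ∈ D₄`,
`F` the spin exchange, `γ_θ` the `U(1)` gauge automorphism, `θ(γ,f,m) = (j(γ) + f + 2m)·π/2`, `j` the `B₁g` twist exponent).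
This file types its action on STATES:
* §1 words: `relabel_ladderWord`, `exists_spinSwapIter_ladderWord` (spin exchange maps ladder words to ladder words with the
  same gauge phases), `gaugeAut_natCast_mul_pi_div_two_ladderWord` (`γ_{kπ/2}(W) = i^{k q(W)} W`), `gaugePhase_add`,
  `gaugePhase_eq_of_mod_four_eq`; `spinSwapIter` is `2`-periodic, linear and commutes with the structure maps `Γ(φ)`.
* §2 states: `spinFlipIter k ω = F^k ω`, `d4Act_d4Act` (`(ω∘g)∘γ = ω∘(gγ)`), `twistedFlipAct g ω = γ_θ(g) (F^{f} (ω∘γ))`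
  (`g = ((γ,f),m)`), its values on ladder words, translation invariance, the density, and the balance of the two spin
  densities in the orbit sum (`sum_twistedFlipAct_re_expect_nAt_zero`).
* §3 **the flip-twisted symmetry defects of a window certificate cancel in the orbit sum of every translation-invariant
  state**: `Σ_g (α_g ω)_{Λ'}(φ • Γ(incl)(Γ(d4Emb γ w Λ)(F^f W)) − Γ(incl) W) = 0` for a ladder word `W`,
  `φ = gaugePhase (twistFlipExp γ f m) W` (`IsTranslationInvariant.sum_twistedFlipAct_expect_twistedFlipDefect_eq_zero`) — the
  abstract-state form of the orbit argument behind `DWaveSourceNNNHoppingTwistedFlipWindowCertificate`, twisted twin of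
  `IsTranslationInvariant.sum_d4Act_expect_d4Defect_eq_zero`.
Everything is PROVED; the definitions (`spinFlipIter`, `twistFlipAngle`, `twistedFlipAct`, `twistFlipActMul`) have bodies;
no named fact, no number, no `sorry`. Tree search: REUSED `d4Act(_expect)`, `IsTranslationInvariant.d4Act/expect_fermionEmbed_d4Emb`,
`d4Act_expect_nAt_zero`, `d4Act_density`, `d4Vec_mul`, `spinFlip(_expect)`, `fermionEmbed_relabel_spinSwap`,
`relabel_spinSwap_relabel_spinSwap/_nAt`, `density_spinFlip`, `gaugeShift(_expect)`, `gaugeAut_apply/_nAt`,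
`fockGaugeU1_mul_pi_div_two`, `fockGauge_conj_ladderWord`, `gaugePhase_eq_I_zpow_charge`, `gaugePhase_map_fst`,
`fermionEmbed_ladderWord`, `relabel_creation/annihilation`, `spinSwapIter`, `twistFlipExp`, `b1gTwist_add`;
`lean search 'twistedFlipAct|spinFlipIter|d4Act_d4Act'`: nothing.

References: O. Bratteli, D. W. Robinson, *OAQSM 1* (1987) §4.3.1 (states composed with automorphisms) [cite: BratteliRobinsonI1987, §4.3.1];
*OAQSM 2* (1997) §5.2.2 (gauge group, Bogoliubov automorphisms) [cite: BratteliRobinsonII1997, §5.2.2]; X. Han, arXiv:2006.06002 §3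
(symmetry reduction of the square-lattice bootstrap) [cite: Han2020Bootstrap, §3]; D. J. Scalapino, Phys. Rep. 250 (1995) §2
(`D₄`, `B₁g`) [cite: Scalapino1995, §2].
-/

noncomputable section

namespace Literature.MathematicalPhysics.QuantumLattice

open Matrix Finset Complex HubbardWave0 Literature.Probability.LatticeModels
open scoped ComplexOrder BigOperators

/-! ## §1 Words: relabelling, spin exchange and gauge quarter turns of ladder words -/

section Words

variable {ι ι' : Type*} [LinearOrder ι] [Fintype ι] [LinearOrder ι'] [Fintype ι']

/-- A Bogoliubov relabelling maps a ladder letter to the relabelled letter. [cite: BratteliRobinsonII1997, §5.2.2] -/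
theorem relabel_ladderLetter (e : ι ≃ ι') (p : ι × Bool) :
    relabel e (ladderLetter p) = ladderLetter (e p.1, p.2) := by
  obtain ⟨j, b⟩ := p
  cases b
  · simp only [ladderLetter, Bool.false_eq_true, if_false]
    exact relabel_annihilation e j
  · simp only [ladderLetter, if_true]
    exact relabel_creation e j

/-- **A Bogoliubov relabelling maps ladder words to ladder words**: `Γ_e(a₁⋯aₖ) = a'₁⋯a'ₖ` with the relabelled
letters. [cite: BratteliRobinsonII1997, §5.2.2] -/
theorem relabel_ladderWord (e : ι ≃ ι') (l : List (ι × Bool)) :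
    relabel e (ladderWord l) = ladderWord (l.map fun p => (e p.1, p.2)) := by
  induction l with
  | nil => simp
  | cons p l ih => rw [ladderWord_cons, map_mul, relabel_ladderLetter, ih, List.map_cons, ladderWord_cons]

omit [Fintype ι] [LinearOrder ι] in
/-- `gaugePhase (a + b) W = gaugePhase a W · gaugePhase b W` (`i^{(a+b)q} = i^{aq} i^{bq}`). [cite: Han2020Bootstrap, §2] -/
theorem gaugePhase_add (a b : ℕ) (l : List (ι × Bool)) :
    gaugePhase (a + b) l = gaugePhase a l * gaugePhase b l := by
  rw [gaugePhase_eq_I_zpow_charge, gaugePhase_eq_I_zpow_charge, gaugePhase_eq_I_zpow_charge, Nat.cast_add, add_mul,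
    zpow_add₀ I_ne_zero]

omit [Fintype ι] [LinearOrder ι] in
/-- The gauge phase depends on the exponent only modulo four (`i⁴ = 1`). [cite: Han2020Bootstrap, §2] -/
theorem gaugePhase_eq_of_mod_four_eq {a b : ℕ} (h : a % 4 = b % 4) (l : List (ι × Bool)) :
    gaugePhase a l = gaugePhase b l := by
  have key : ∀ n : ℕ, gaugePhase n l = gaugePhase (n % 4) l := by
    intro n
    conv_lhs => rw [← Nat.mod_add_div n 4]
    rw [gaugePhase_add, gaugePhase_eq_I_zpow_charge (4 * (n / 4)), Nat.cast_mul,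
      show ((4 : ℕ) : ℤ) * ((n / 4 : ℕ) : ℤ) * ladderCharge l = 4 * (((n / 4 : ℕ) : ℤ) * ladderCharge l) by push_cast; ring,
      _root_.zpow_mul, show (I : ℂ) ^ (4 : ℤ) = 1 from I_pow_four, _root_.one_zpow, mul_one]
  rw [key a, key b, h]

/-- **The gauge quarter turns act on ladder words by their gauge phases**: `γ_{kπ/2}(W) = i^{k·q(W)} · W`
(`γ_θ(a) = e^{iθN̂} a e^{−iθN̂}`, `e^{i(kπ/2)N̂} = 𝒢_k`). [cite: BratteliRobinsonII1997, §5.2.2] -/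
theorem gaugeAut_natCast_mul_pi_div_two_ladderWord (k : ℕ) (l : List (ι × Bool)) :
    gaugeAut ((k : ℝ) * (Real.pi / 2)) (ladderWord l : Matrix (Finset ι) (Finset ι) ℂ) = gaugePhase k l • ladderWord l := by
  rw [gaugeAut_apply, fockGaugeU1_mul_pi_div_two, fockGauge_conj_ladderWord]

end Words

/-! ### The iterated spin exchange `spinSwapIter` of window observables -/

section SpinSwap

variable {Λ Λ' : Finset (Site 2)}

/-- `F^{a} (F^{b} A) = F^{a+b} A`. [cite: Han2020Bootstrap, §3] -/
theorem spinSwapIter_spinSwapIter (a b : ℕ) (A : FermionOp Λ) :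
    spinSwapIter a (spinSwapIter b A) = spinSwapIter (a + b) A := by
  rw [spinSwapIter, spinSwapIter, spinSwapIter, ← Function.iterate_add_apply]

/-- `F² = 1`: `F^{k} A = F^{k mod 2} A`. [cite: Han2020Bootstrap, §3] -/
theorem spinSwapIter_eq_mod_two (k : ℕ) (A : FermionOp Λ) : spinSwapIter k A = spinSwapIter (k % 2) A := by
  have h2 : ∀ B : FermionOp Λ, spinSwapIter 2 B = B := fun B => relabel_spinSwap_relabel_spinSwap B
  have key : ∀ n : ℕ, spinSwapIter (2 * n) A = A := by
    intro n
    induction n with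
    | zero => rw [mul_zero, spinSwapIter_zero]
    | succ n ih => rw [Nat.mul_succ, ← spinSwapIter_spinSwapIter, h2, ih]
  conv_lhs => rw [← Nat.mod_add_div k 2, ← spinSwapIter_spinSwapIter, key]

/-- `spinSwapIter` commutes with scalars. [cite: Han2020Bootstrap, §3] -/
theorem spinSwapIter_smul (k : ℕ) (c : ℂ) (A : FermionOp Λ) : spinSwapIter k (c • A) = c • spinSwapIter k A := by
  induction k with
  | zero => rfl
  | succ k ih => rw [spinSwapIter_succ, spinSwapIter_succ, ih, map_smul]

/-- **The spin exchange commutes with the structure maps**: `F^{k} (Γ(φ) A) = Γ(φ) (F^{k} A)`.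
[cite: BratteliRobinsonII1997, §5.2.2] -/
theorem spinSwapIter_fermionEmbed (k : ℕ) (φ : PolySite Λ ↪ PolySite Λ') (A : FermionOp Λ) :
    spinSwapIter k (fermionEmbed φ A) = fermionEmbed φ (spinSwapIter k A) := by
  induction k with
  | zero => rfl
  | succ k ih => rw [spinSwapIter_succ, spinSwapIter_succ, ih, fermionEmbed_relabel_spinSwap]

/-- **The spin exchange maps ladder words to ladder words with the same gauge phases** (only the spin labels
of the letters change). [cite: Han2020Bootstrap, §3] -/
theorem exists_spinSwapIter_ladderWord (k : ℕ) (l : List (Orb (PolySite Λ) × Bool)) :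
    ∃ l' : List (Orb (PolySite Λ) × Bool), spinSwapIter k (ladderWord l) = ladderWord l' ∧
      ∀ j : ℕ, gaugePhase j l' = gaugePhase j l := by
  induction k with
  | zero => exact ⟨l, rfl, fun _ => rfl⟩
  | succ k ih =>
    obtain ⟨l', hl', hph⟩ := ih
    refine ⟨l'.map fun p => ((Orb.spinSwap : Orb (PolySite Λ) ≃ Orb (PolySite Λ)) p.1, p.2), ?_, fun j => ?_⟩
    · rw [spinSwapIter_succ, hl', relabel_ladderWord]
    · rw [gaugePhase_map_fst, hph]

/-- **A flip-twisted image of a ladder word is a ladder word with the same gauge phases**: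
`Γ(incl)(Γ(d4Emb γ w Λ)(F^{f} W)) = W'` with `gaugePhase j W' = gaugePhase j W` for all `j`.
[cite: Han2020Bootstrap, §3] -/
theorem exists_fermionEmbed_d4Emb_spinSwapIter_ladderWord {Λ'' : Finset (Site 2)} (γ : DihedralGroup 4) (w : Site 2)
    (hsh : d4ShiftSet γ w Λ ⊆ Λ'') (f : ℕ) (l : List (Orb (PolySite Λ) × Bool)) :
    ∃ L : List (Orb (PolySite Λ'') × Bool),
      fermionEmbed (PolySite.incl hsh) (fermionEmbed (PolySite.d4Emb γ w Λ) (spinSwapIter f (ladderWord l))) = ladderWord L ∧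
        ∀ j : ℕ, gaugePhase j L = gaugePhase j l := by
  obtain ⟨l', hl', hph⟩ := exists_spinSwapIter_ladderWord f l
  refine ⟨(l'.map fun p => (Orb.embMap (PolySite.d4Emb γ w Λ) p.1, p.2)).map
      fun p => (Orb.embMap (PolySite.incl hsh) p.1, p.2), ?_, fun j => ?_⟩
  · rw [hl', fermionEmbed_ladderWord, fermionEmbed_ladderWord]
  · rw [gaugePhase_map_fst, gaugePhase_map_fst, hph]

end SpinSwap

/-! ## §2 The action on states -/

namespace InfVolFermionState

/-! ### Iterated spin flip -/

section Flip

variable {d : ℕ}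

/-- The `k`-fold spin flip `F^k ω` of a state (`k = 0, 1` in the certificates). [cite: BratteliRobinsonI1987, §4.3.1] -/
def spinFlipIter (k : ℕ) (ω : InfVolFermionState d) : InfVolFermionState d := spinFlip^[k] ω

/-- `F^0 ω = ω`. [cite: BratteliRobinsonI1987, §4.3.1] -/
@[simp] theorem spinFlipIter_zero (ω : InfVolFermionState d) : ω.spinFlipIter 0 = ω := rfl

/-- `F^{k+1} ω = F^{k} (F ω)`. [cite: BratteliRobinsonI1987, §4.3.1] -/
theorem spinFlipIter_succ (k : ℕ) (ω : InfVolFermionState d) : ω.spinFlipIter (k + 1) = ω.spinFlip.spinFlipIter k := by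
  rw [spinFlipIter, spinFlipIter, Function.iterate_succ_apply]

/-- **The local expectations of `F^k ω`**: `(F^k ω)_Λ(A) = ω_Λ(F^k A)`. [cite: BratteliRobinsonI1987, §4.3.1] -/
theorem spinFlipIter_expect (k : ℕ) (ω : InfVolFermionState 2) (Λ : Finset (Site 2)) (A : FermionOp Λ) :
    (ω.spinFlipIter k).expect Λ A = ω.expect Λ (spinSwapIter k A) := by
  induction k generalizing A with
  | zero => rfl
  | succ k ih =>
    rw [spinFlipIter, Function.iterate_succ_apply', ← spinFlipIter, spinFlip_expect, ih, spinSwapIter,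
      spinSwapIter, ← Function.iterate_succ_apply, Function.iterate_succ_apply']

/-- `F^k ω` is translation invariant when `ω` is. [cite: ArakiMoriya2003, §4.1 Def. 4.5] -/
theorem IsTranslationInvariant.spinFlipIter {ω : InfVolFermionState d} (hω : ω.IsTranslationInvariant) (k : ℕ) :
    (ω.spinFlipIter k).IsTranslationInvariant := by
  induction k generalizing ω with
  | zero => exact hω
  | succ k ih => rw [spinFlipIter_succ]; exact ih hω.spinFlip

/-- `F^k ω` has the density of `ω`. [cite: ArakiMoriya2003, §4.1] -/
theorem density_spinFlipIter (k : ℕ) (ω : InfVolFermionState d) : (ω.spinFlipIter k).density = ω.density := by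
  induction k generalizing ω with
  | zero => rfl
  | succ k ih => rw [spinFlipIter_succ, ih, density_spinFlip]

end Flip

/-! ### Composition of point-group transforms -/

/-- **`(ω ∘ g) ∘ γ = ω ∘ (gγ)`**: the point group acts on states (`Γ(g) ∘ Γ(γ) = Γ(gγ)` on every local algebra,
up to the isotony identification `g(γΛ) = (gγ)Λ`). [cite: BratteliRobinsonI1987, §4.3.1] -/
theorem d4Act_d4Act (ω : InfVolFermionState 2) (g γ : DihedralGroup 4) : (ω.d4Act g).d4Act γ = ω.d4Act (g * γ) := by
  refine InfVolFermionState.ext fun Λ => LinearMap.ext fun A => ?_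
  have hsub : d4ShiftSet (g * γ) 0 Λ ⊆ d4ShiftSet g 0 (d4ShiftSet γ 0 Λ) := by
    intro x hx
    obtain ⟨y, hy, rfl⟩ := (mem_d4ShiftSet_iff _ _ _ x).1 hx
    rw [mem_d4ShiftSet_iff]
    exact ⟨d4Vec γ y + 0, d4Vec_add_mem_d4ShiftSet γ 0 hy, by rw [add_zero, add_zero, add_zero, d4Vec_mul]⟩
  rw [d4Act_expect, d4Act_expect, d4Act_expect, fermionEmbed_fermionEmbed, ← ω.compatible hsub,
    fermionEmbed_fermionEmbed]
  exact congrArg (ω.expect _) (congrFun (congrArg DFunLike.coe (fermionEmbed_congr fun y => Subtype.ext (by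
    show toLex (d4Vec g (ofLex (toLex (d4Vec γ (ofLex y.1) + 0))) + 0) = toLex (d4Vec (g * γ) (ofLex y.1) + 0)
    rw [ofLex_toLex, add_zero, add_zero, add_zero, d4Vec_mul]))) A)

/-! ### The flip-twisted transforms -/

/-- The index set of the flip-twisted point operations: `((γ, f), m)` with `γ ∈ D₄`, flip bit `f`, parity bit `m`
(the torus family `twistedFlipSpaceGroupUnitary` without its translation part). [cite: Han2020Bootstrap, §3] -/
abbrev TwistFlipIndex : Type := (DihedralGroup 4 × Fin 2) × Fin 2

/-- The gauge angle `θ(γ,f,m) = (j(γ) + f + 2m)·π/2` of the index `((γ,f),m)`. [cite: BratteliRobinsonII1997, §5.2.2] -/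
def twistFlipAngle (g : TwistFlipIndex) : ℝ := (twistFlipExp g.1.1 g.1.2 g.2 : ℝ) * (Real.pi / 2)

/-- **The flip-twisted transform `α_g ω = (F^{f} (ω ∘ γ)) ∘ γ_{θ(g)}` of an infinite-volume state** (`g = ((γ,f),m)`):
point-group transform, then `f` spin flips, then the gauge transform at the angle `θ(g)`. Each step is a state, so
`α_g ω` is a state. [cite: BratteliRobinsonI1987, §4.3.1] -/
def twistedFlipAct (g : TwistFlipIndex) (ω : InfVolFermionState 2) : InfVolFermionState 2 :=
  ((ω.d4Act g.1.1).spinFlipIter g.1.2.val).gaugeShift (twistFlipAngle g)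

/-- **The local expectations of `α_g ω`**: `(α_g ω)_Λ(A) = (ω ∘ γ)_Λ(F^{f}(γ_{θ(g)} A))`. [cite: BratteliRobinsonI1987, §4.3.1] -/
theorem twistedFlipAct_expect (g : TwistFlipIndex) (ω : InfVolFermionState 2) (Λ : Finset (Site 2)) (A : FermionOp Λ) :
    (ω.twistedFlipAct g).expect Λ A = (ω.d4Act g.1.1).expect Λ (spinSwapIter g.1.2.val (gaugeAut (twistFlipAngle g) A)) := by
  rw [twistedFlipAct, gaugeShift_expect, spinFlipIter_expect]

/-- **On a ladder word `α_g ω` reads the gauge phase**: `(α_g ω)_Λ(W) = i^{e(g)·q(W)} · (ω ∘ γ)_Λ(F^{f} W)`.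
[cite: BratteliRobinsonII1997, §5.2.2] -/
theorem twistedFlipAct_expect_ladderWord (g : TwistFlipIndex) (ω : InfVolFermionState 2) (Λ : Finset (Site 2))
    (l : List (Orb (PolySite Λ) × Bool)) :
    (ω.twistedFlipAct g).expect Λ (ladderWord l) =
      gaugePhase (twistFlipExp g.1.1 g.1.2 g.2) l * (ω.d4Act g.1.1).expect Λ (spinSwapIter g.1.2.val (ladderWord l)) := by
  rw [twistedFlipAct_expect, twistFlipAngle, gaugeAut_natCast_mul_pi_div_two_ladderWord, spinSwapIter_smul, map_smul,
    smul_eq_mul]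

/-- **`α_g ω` is translation invariant when `ω` is.** [cite: BratteliRobinsonI1987, §4.3.1] -/
theorem IsTranslationInvariant.twistedFlipAct {ω : InfVolFermionState 2} (hω : ω.IsTranslationInvariant)
    (g : TwistFlipIndex) : (ω.twistedFlipAct g).IsTranslationInvariant :=
  ((hω.d4Act g.1.1).spinFlipIter _).gaugeShift _

/-- The gauge transform does not change the density (`n_{0σ}` is gauge invariant). [cite: BratteliRobinsonII1997, §5.2.2] -/
theorem density_gaugeShift {d : ℕ} (θ : ℝ) (ω : InfVolFermionState d) : (ω.gaugeShift θ).density = ω.density := by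
  simp only [density, densityAt, gaugeShift_expect, map_add, gaugeAut_nAt]

/-- **`α_g ω` has the density of `ω`.** [cite: BratteliRobinsonI1987, §4.3.1] -/
theorem twistedFlipAct_density (g : TwistFlipIndex) (ω : InfVolFermionState 2) : (ω.twistedFlipAct g).density = ω.density := by
  rw [twistedFlipAct, density_gaugeShift, density_spinFlipIter, d4Act_density]

/-- `F^{k} n_{0σ} = n_{0, swap^k σ}` in a window. [cite: BratteliRobinsonII1997, §5.2.2 Thm. 5.2.5] -/
theorem spinSwapIter_nAt {Λ : Finset (Site 2)} (k : ℕ) (x : Site 2) (hx : x ∈ Λ) (σ : Fin 2) :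
    spinSwapIter k (nAt x hx σ) = nAt x hx ((Equiv.swap (0 : Fin 2) 1)^[k] σ) := by
  induction k with
  | zero => rfl
  | succ k ih => rw [spinSwapIter_succ, ih, relabel_spinSwap_nAt, Function.iterate_succ_apply']

/-- **The origin spin densities of `α_g ω`**: `(α_g ω)(n_{0σ}) = ω(n_{0, swap^f σ})`. [cite: Scalapino1995, §2] -/
theorem twistedFlipAct_expect_nAt_zero (g : TwistFlipIndex) (ω : InfVolFermionState 2) {Λ' : Finset (Site 2)}
    (hz : (0 : Site 2) ∈ Λ') (σ : Fin 2) :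
    (ω.twistedFlipAct g).expect Λ' (nAt 0 hz σ) = ω.expect Λ' (nAt 0 hz ((Equiv.swap (0 : Fin 2) 1)^[g.1.2.val] σ)) := by
  rw [twistedFlipAct_expect, gaugeAut_nAt, spinSwapIter_nAt, d4Act_expect_nAt_zero]

/-- **The two spin densities balance in the orbit sum**: `Σ_g Re (α_g ω)(n_{0σ}) = 16·ρ(ω)` for each `σ`
(the flip bit runs over both values). [cite: Han2020Bootstrap, §3] -/
theorem sum_twistedFlipAct_re_expect_nAt_zero (ω : InfVolFermionState 2) {Λ' : Finset (Site 2)}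
    (hz : (0 : Site 2) ∈ Λ') (σ : Fin 2) :
    ∑ g : TwistFlipIndex, ((ω.twistedFlipAct g).expect Λ' (nAt 0 hz σ)).re = 16 * ω.density := by
  set F : Fin 2 → ℝ := fun f => (ω.expect Λ' (nAt 0 hz ((Equiv.swap (0 : Fin 2) 1)^[f.val] σ))).re with hF
  have hF2 : ∑ f : Fin 2, F f = ω.density := by
    rw [← ω.sum_re_expect_nAt_zero_eq_density hz, Fin.sum_univ_two, Fin.sum_univ_two, hF]
    simp only [Fin.val_zero, Fin.val_one, Function.iterate_zero_apply, Function.iterate_one]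
    fin_cases σ
    · simp only [Fin.zero_eta, Fin.isValue, Equiv.swap_apply_left]
    · simp only [Fin.mk_one, Fin.isValue, Equiv.swap_apply_right]; rw [add_comm]
  have h8 : Fintype.card (DihedralGroup 4) = 8 := by rfl
  calc ∑ g : TwistFlipIndex, ((ω.twistedFlipAct g).expect Λ' (nAt 0 hz σ)).re
      = ∑ g : TwistFlipIndex, F g.1.2 := Finset.sum_congr rfl fun g _ => by rw [twistedFlipAct_expect_nAt_zero]
    _ = ∑ p : DihedralGroup 4 × Fin 2, ∑ _m : Fin 2, F p.2 := Fintype.sum_prod_type _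
    _ = ∑ p : DihedralGroup 4 × Fin 2, (2 : ℝ) * F p.2 := Finset.sum_congr rfl fun p _ => by
        rw [Finset.sum_const, Finset.card_univ, Fintype.card_fin, nsmul_eq_mul, Nat.cast_ofNat]
    _ = ∑ _γ : DihedralGroup 4, ∑ f : Fin 2, (2 : ℝ) * F f := Fintype.sum_prod_type _
    _ = ∑ _γ : DihedralGroup 4, (2 : ℝ) * ω.density := Finset.sum_congr rfl fun _ _ => by
        rw [← Finset.mul_sum, hF2]
    _ = 16 * ω.density := by
        rw [Finset.sum_const, Finset.card_univ, h8, nsmul_eq_mul, Nat.cast_ofNat]; ring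

/-! ## §3 The flip-twisted defects cancel in the orbit sum -/

/-- The index of `α_g ∘ α_l`: `((γ_g γ_l, f_g + f_l mod 2), m')` with the parity bit absorbing the carries
(`twistFlipMulIndex` of the torus family without its translation part). [cite: Han2020Bootstrap, §3] -/
def twistFlipActMul (γ₀ : DihedralGroup 4) (f₀ m₀ : Fin 2) (g : TwistFlipIndex) : TwistFlipIndex :=
  ((g.1.1 * γ₀, ⟨(g.1.2.val + f₀.val) % 2, Nat.mod_lt _ (by norm_num)⟩),
    ⟨(g.2.val + m₀.val + twistCarry g.1.1 γ₀ + (g.1.2.val + f₀.val) / 2) % 2, Nat.mod_lt _ (by norm_num)⟩)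

/-- The index map is injective. [cite: Han2020Bootstrap, §3] -/
theorem twistFlipActMul_injective (γ₀ : DihedralGroup 4) (f₀ m₀ : Fin 2) :
    Function.Injective (twistFlipActMul γ₀ f₀ m₀) := by
  rintro ⟨⟨γ, f⟩, m⟩ ⟨⟨γ', f'⟩, m'⟩ h
  simp only [twistFlipActMul, Prod.mk.injEq, Fin.mk.injEq] at h
  obtain ⟨⟨h1, h2⟩, h3⟩ := h
  obtain rfl : γ = γ' := mul_right_cancel h1
  obtain rfl : f = f' := Fin.ext (by have := f.isLt; have := f'.isLt; omega)
  obtain rfl : m = m' := Fin.ext (by have := m.isLt; have := m'.isLt; omega)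
  rfl

/-- **The twist exponents add up modulo four under the index map.** [cite: Han2020Bootstrap, §3] -/
theorem twistFlipExp_twistFlipActMul_mod_four (γ₀ : DihedralGroup 4) (f₀ m₀ : Fin 2) (g : TwistFlipIndex) :
    (twistFlipExp g.1.1 g.1.2 g.2 + twistFlipExp γ₀ f₀ m₀) % 4 =
      twistFlipExp (twistFlipActMul γ₀ f₀ m₀ g).1.1 (twistFlipActMul γ₀ f₀ m₀ g).1.2 (twistFlipActMul γ₀ f₀ m₀ g).2 % 4 := by
  have hadd := b1gTwist_add g.1.1 γ₀
  simp only [twistFlipExp, twistFlipActMul]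
  omega

/-- **`α_g ω` on a flip-twisted image of a ladder word** (translation-invariant `ω`): for `W = ladderWord l ∈ 𝔄_Λ`,
`(α_g ω)_{Λ'}(Γ(incl)(Γ(d4Emb γ w Λ)(F^{f} W))) = i^{e(g)q(W)} · (ω ∘ γ_g γ)_Λ(F^{(f_g + f) mod 2} W)` — the translation
`w` is absorbed by translation invariance, the point operations compose. [cite: Han2020Bootstrap, §3] -/
theorem IsTranslationInvariant.twistedFlipAct_expect_fermionEmbed_d4Emb_spinSwapIter_ladderWord
    {ω : InfVolFermionState 2} (hω : ω.IsTranslationInvariant) (g : TwistFlipIndex)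
    {Λ Λ' : Finset (Site 2)} (γ : DihedralGroup 4) (w : Site 2) (hsh : d4ShiftSet γ w Λ ⊆ Λ') (f : ℕ)
    (l : List (Orb (PolySite Λ) × Bool)) :
    (ω.twistedFlipAct g).expect Λ'
        (fermionEmbed (PolySite.incl hsh) (fermionEmbed (PolySite.d4Emb γ w Λ) (spinSwapIter f (ladderWord l)))) =
      gaugePhase (twistFlipExp g.1.1 g.1.2 g.2) l *
        (ω.d4Act (g.1.1 * γ)).expect Λ (spinSwapIter ((g.1.2.val + f) % 2) (ladderWord l)) := by
  obtain ⟨L, hL, hph⟩ := exists_fermionEmbed_d4Emb_spinSwapIter_ladderWord γ w hsh f l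
  rw [hL, twistedFlipAct_expect_ladderWord, hph, ← hL, spinSwapIter_fermionEmbed, spinSwapIter_fermionEmbed,
    spinSwapIter_spinSwapIter, (hω.d4Act g.1.1).expect_fermionEmbed_d4Emb γ w hsh, d4Act_d4Act,
    spinSwapIter_eq_mod_two (g.1.2.val + f)]

/-- **`α_g ω` on the embedded word itself**: `(α_g ω)_{Λ'}(Γ(incl) W) = i^{e(g)q(W)} · (ω ∘ γ_g)_Λ(F^{f_g} W)`.
[cite: Han2020Bootstrap, §3] -/
theorem twistedFlipAct_expect_fermionEmbed_incl_ladderWord (ω : InfVolFermionState 2) (g : TwistFlipIndex)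
    {Λ Λ' : Finset (Site 2)} (hΛ : Λ ⊆ Λ') (l : List (Orb (PolySite Λ) × Bool)) :
    (ω.twistedFlipAct g).expect Λ' (fermionEmbed (PolySite.incl hΛ) (ladderWord l)) =
      gaugePhase (twistFlipExp g.1.1 g.1.2 g.2) l * (ω.d4Act g.1.1).expect Λ (spinSwapIter g.1.2.val (ladderWord l)) := by
  have hL := fermionEmbed_ladderWord (PolySite.incl hΛ) l
  rw [hL, twistedFlipAct_expect_ladderWord, gaugePhase_map_fst, ← hL, spinSwapIter_fermionEmbed,
    (ω.d4Act g.1.1).compatible hΛ]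

/-- **The flip-twisted symmetry defects of a window certificate cancel in the orbit sum of every
translation-invariant state**: for a ladder word `W = ladderWord l ∈ 𝔄_Λ`, a point operation `γ`, a translation
`w` with `γΛ + w ⊆ Λ'`, a flip bit `f`, a parity bit `m` and the gauge phase `φ = gaugePhase (twistFlipExp γ f m) W`,
`Σ_g (α_g ω)_{Λ'}(φ • Γ(incl)(Γ(d4Emb γ w Λ)(F^{f} W)) − Γ(incl) W) = 0`
(the first terms are a re-indexing `g ↦ g·(γ,f,m)` of the second). The abstract-state counterpart of the
orbit-state readers of `DWaveSourceNNNHoppingTwistedFlipWindowCertificate`; twisted twin of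
`IsTranslationInvariant.sum_d4Act_expect_d4Defect_eq_zero`. [cite: Han2020Bootstrap, §2 eq. (cons) and §3] -/
theorem IsTranslationInvariant.sum_twistedFlipAct_expect_twistedFlipDefect_eq_zero {ω : InfVolFermionState 2}
    (hω : ω.IsTranslationInvariant) {Λ Λ' : Finset (Site 2)} (hΛ : Λ ⊆ Λ')
    (γ : DihedralGroup 4) (w : Site 2) (hsh : d4ShiftSet γ w Λ ⊆ Λ') (f m : Fin 2)
    (l : List (Orb (PolySite Λ) × Bool)) :
    ∑ g : TwistFlipIndex, (ω.twistedFlipAct g).expect Λ'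
      (gaugePhase (twistFlipExp γ f m) l •
          fermionEmbed (PolySite.incl hsh) (fermionEmbed (PolySite.d4Emb γ w Λ) (spinSwapIter f.val (ladderWord l))) -
        fermionEmbed (PolySite.incl hΛ) (ladderWord l)) = 0 := by
  set Φ : TwistFlipIndex → ℂ := fun g =>
    gaugePhase (twistFlipExp g.1.1 g.1.2 g.2) l * (ω.d4Act g.1.1).expect Λ (spinSwapIter g.1.2.val (ladderWord l)) with hΦ
  set σ := twistFlipActMul γ f m with hσ
  have h1 : ∀ g : TwistFlipIndex, (ω.twistedFlipAct g).expect Λ'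
      (gaugePhase (twistFlipExp γ f m) l •
        fermionEmbed (PolySite.incl hsh) (fermionEmbed (PolySite.d4Emb γ w Λ) (spinSwapIter f.val (ladderWord l)))) =
      Φ (σ g) := by
    intro g
    rw [map_smul, smul_eq_mul, hω.twistedFlipAct_expect_fermionEmbed_d4Emb_spinSwapIter_ladderWord, ← mul_assoc,
      mul_comm (gaugePhase (twistFlipExp γ f m) l), ← gaugePhase_add,
      gaugePhase_eq_of_mod_four_eq (twistFlipExp_twistFlipActMul_mod_four γ f m g) l, hΦ]
    rfl
  have h2 : ∀ g : TwistFlipIndex, (ω.twistedFlipAct g).expect Λ' (fermionEmbed (PolySite.incl hΛ) (ladderWord l)) = Φ g :=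
    fun g => ω.twistedFlipAct_expect_fermionEmbed_incl_ladderWord g hΛ l
  simp_rw [map_sub, h1, h2]
  rw [Finset.sum_sub_distrib, sub_eq_zero]
  exact Equiv.sum_comp (Equiv.ofBijective σ (Finite.injective_iff_bijective.mp (twistFlipActMul_injective γ f m))) Φ

end InfVolFermionState

end Literature.MathematicalPhysics.QuantumLattice

end
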